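/-
Copyright (c) 2026 the pub-hodgecm-mathlib formalisation cell (harness21).  Prover seat hodgecm-mathlib-K2Liu-p05 (g4), 2026-09-04
(Track B «K2-LIT», crux hLiu418 = stmt-HodgeConjecture-24832, socket #42F′, ROAD I v3, organ G2-Weil, bridge (G2-W4) part W4-ii (assembly):
the Siegel–Weil section is `C^∞` along `U(2,2)` at a real place on product vectors).
-/
import Summits.HodgeConjecture.HodgeConjecture.Theorems.K2LiuSwSectionArchOrbitSmooth        -- ★ p858481 (W4-ii reduction): `exists_clm_swSection_tmul_mul_archToAdelic`
import Summits.HodgeConjecture.HodgeConjecture.Theorems.K2LiuArchSectionPlaceJunction        -- ★ p858444 (W4-i junction): `placeSecJ`, `archSectionRepJ`, `contDiffAt_archSectionRepJ_placeSecJ`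
import HarnessLib

/-!
# (G2-W4-ii, assembly) The Siegel–Weil section `x ↦ f_{a ⊗ f}(h · k_σ(x))` is `C^∞` along `U(2,2)` at a real place `σ` on product vectors

Track B ∕ K2-LIT, hLiu418 = stmt-HodgeConjecture-24832, #42F′ ROAD I v3 organ G2-Weil, bridge (G2-W4) (LEAD F0P6-plan (g12) RULING M-156j (3) «W4-ii ⇒
`hasDerivAt_swSection_arch_orbit`»; HANDOFF v26 deal «p05 (g4): (1) `contDiffAt_swSection_tmul_placeSecJ` (frame identity + `ContDiffAt.mul` legs)»).
Namespace `Summit.HodgeConjecture.HodgeConjecture.Cruxes.HLiu418.K2LiuSwSectionArchOrbit` (continued).  THEOREMS ONLY (no definition, no instance,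
no notation, no named fact, no `sorry`); `--supports stmt-HodgeConjecture-24832 --as helper`.

INPUTS BY NAME: (W4-ii reduction) ★ `exists_clm_swSection_tmul_mul_archToAdelic` — for ANY `χ`-normalised doubled Weil representation `sD`, `h ∈ H(𝔸)`,
`f ∈ 𝒮(X_f)`, ONE continuous linear functional `ℓ` on `𝓢(X_∞)` with `swSection sD (a ⊗ f) (h · k) = η_t(k) · ℓ (carrierConjEquiv e_D (s_∞ k) a)`; (W4-i) ★
`contDiffAt_archSectionRepJ_placeSecJ` — Folland's section read in the junction frame `J_σ = DPIdx P′ Q′ 1 ∅ ⊕ (Fin N × {v ≠ σ})` (`archSectionRepJ`) is `C^∞`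
along `placeSecJ σ (c x, 1)` on product vectors.
* §1 (generic `(E, c, N, J = diag t₀ ⊗ 1, δ)`, any Folland frame `S`) **`carrierConjEquiv_eq_symm_archSectionRepJ`** — THE FRAME IDENTITY
  `carrierConjEquiv S (s_∞ k) a = 𝒥⁻¹ (archSectionRepJ k (𝒥 a))`, `𝒥 := S_* ≫ T₁ ≫ T₂ ≫ T₃` (scaled frame, then the three `reindexCLE` transports);
* §2 (doubled CM frame: `E = L`, `J = hermD`, `N = n + n`, `wOf = cmPlaceOver`, `δ = imagUnit`) **`exists_clm_swSection_tmul_mul_archEmb_placeSecJ`** — ONE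
  continuous linear functional `ℓ′ = ℓ ∘ 𝒥⁻¹` on `𝓢(ℝ^{J_σ})` with `swSection sD (a ⊗ f) (h · placeSecJ σ u) = η_t(placeSecJ σ u) · ℓ′ (archSectionRepJ σ (placeSecJ σ u) (𝒥 a))`
  for ALL `u`, `a`; `continuous_coe_etaD_placeSecJ` (★ `continuous_coe_archDetZPow`);
* §3 **`contDiffAt_swSection_tmul_placeSecJ`** — for `σ` with sign types `P_σ ≃ Fin 2`, `Q_σ ≃ Fin 2`, matrix-smooth `c : B → U(2,2)` and `a` with `𝒥 a = Φ₁ ⊠ Φ₂`: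
  `x ↦ swSection sD (a ⊗ f) (h · placeSecJ σ (c x, 1))` is `C^∞` at `x₀` (character leg ★ `contDiffAt_character_inl`, Folland leg ★ `contDiffAt_archSectionRepJ_placeSecJ`,
  `ContDiffAt.mul`).
NOT here (sequel `K2LiuSwSectionArchOrbitDeriv`): the one-parameter case `t ↦ f_{a ⊗ f}(h · placeSecJ σ (exp (tY), 1))` (`Y ∈ 𝔲(2,2)`), the factor character `χ` of ★
`exists_circle_twist_factorisation_placeSecJ` pinned, and the EXPLICIT derivative vector (`hasDerivAt_swSection_arch_orbit`).

HONEST LABEL: HC_CM is proved only modulo the 7 printed citations (2 remaining named inputs: hLiu418 = stmt-HodgeConjecture-24832, h413 =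
stmt-HodgeConjecture-24833) until rung 0 closes; organ capital for #42F′'s Road I, moves no counter.

## References
[Weil1964] A. Weil, Acta Math. 111 (1964), Chap. I n° 11–12, Chap. III n° 38–39 · [Folland1989] G. B. Folland, *Harmonic Analysis in Phase Space* (1989),
Prop. (1.43), §4.2 (4.23)–(4.24), Prop. (4.39) · [Varadarajan1984] V. S. Varadarajan, *Lie Groups, Lie Algebras, and Their Representations* (1984), Thm. 2.10.1,
Thm. 2.11.2 · [GelbartRogawski1991] Invent. Math. 105 (1991), §3.1 Prop. 3.1.1 · [KudlaRallis1994] Ann. of Math. 140 (1994), §1 · [Paul1998] J. Funct. Anal. 159, §1.2.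
-/

set_option autoImplicit false
set_option linter.dupNamespace false

noncomputable section

open scoped Classical Matrix TensorProduct SchwartzMap Matrix.Norms.Operator
open NumberField NumberField.InfinitePlace NumberField.mixedEmbedding IsDedekindDomain
open Literature.Analysis.SegalBargmann
open Literature.RepresentationTheory.HeisenbergGroup
open Literature.NumberTheory.Automorphic Literature.NumberTheory.Automorphic.UnitaryGroup
open Literature.NumberTheory.Weil1964 Literature.NumberTheory.Weil1964.MpS
open Literature.RepresentationTheory.HarrisKudlaSweet1996 Literature.NumberTheory.GaloisRepresentations
open Literature.NumberTheory.GelbartRogawski1991 Literature.NumberTheory.GelbartRogawski1991.UnitaryDualPair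
open Literature.NumberTheory.GelbartRogawski1991.UnitaryDualPair.LocalSplitting
open Literature.NumberTheory.GelbartRogawski1991.GRConstruction
open Literature.NumberTheory.K2Lit.SiegelDoubled
open Literature.RepresentationTheory.KonnoKonno2007 hiding LetterKind letterOf letterGen letterOf_boost letterOf_torus letterOf_torus_eq
  letterGen_boost letterGen_torus letterGen_mem_lie exp_smul_letterGen
open Literature.RepresentationTheory.KonnoKonno2007.RealDualPair
open Summit.HodgeConjecture.HodgeConjecture.Cruxes.HLiu418.K2LiuArchSectionPlaceBlock
open Summit.HodgeConjecture.HodgeConjecture.Cruxes.HLiu418 (K2LiuArchOneParameterOrbitDefs.archEmb)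

namespace Summit.HodgeConjecture.HodgeConjecture.Cruxes.HLiu418.K2LiuSwSectionArchOrbit

/-! ## §1 Generic: Folland's section in the scaled frame IS `archSectionRepJ`, read back through the frame `𝒥` -/
section Frame
variable {F : Type} [Field F] [NumberField F] (E : Type) [Field E] [NumberField E] [Algebra F E] (c : E ≃ₐ[F] E)
  (N : ℕ) (hc : c ≠ 1)
  (wOf : {v : InfinitePlace F // v.IsReal} → {w : InfinitePlace E // w.IsComplex})
  (hw : ∀ v, c • (wOf v).1 = (wOf v).1) (t₀ : Fin N → F) (ht0 : ∀ j, t₀ j ≠ 0) {δ : E} (hcδ : c δ = -δ) (hδ : δ ≠ 0)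
  (σ : {v : InfinitePlace F // v.IsReal})
  (hover : ∀ v, (wOf v).1.comap (algebraMap F E) = v.1) {T : Matrix (Fin N) (Fin N) F} (hTd : T = Matrix.diagonal t₀)
  {J : Matrix (Fin N) (Fin N) E} (hJ : J = T.map (algebraMap F E))
  {P' Q' : Type} [Fintype P'] [DecidableEq P'] [Fintype Q'] [DecidableEq Q']
  (eP : PosIdx (signVec wOf t₀ δ σ) ≃ P') (eQ : NegIdx (signVec wOf t₀ δ σ) ≃ Q')
  {D : Type*} [NormedAddCommGroup D] [NormedSpace ℝ D]

omit [DecidableEq P'] [DecidableEq Q'] in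
/-- **THE FRAME IDENTITY.**  For every Folland frame `S : D ≃L ℝ^{Fin N × places}`, every `k ∈ U(J)(F ⊗ ℝ)` and every `a ∈ 𝓢(D)`:
`carrierConjEquiv S (s_∞ k) a = 𝒥⁻¹ (archSectionRepJ k (𝒥 a))`, where `𝒥 = S_* ≫ T₁ ≫ T₂ ≫ T₃` is the scaled frame followed by the three index transports
of `archSectionRepJ` (split at `σ` ★ `placeSplitEquiv`, junction relabelling ★ `unitJunctionIdx`, block types ★ `dpIdxCongr`) — `repTransport_apply` three times and
`carrierConjEquiv_apply`. [cite: Folland1989, §1.3 (1.25), §4.2 (4.23)] [cite: Weil1964, Chap. I n° 12 p. 160] -/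
theorem carrierConjEquiv_eq_symm_archSectionRepJ (S : D ≃L[ℝ] ((Fin N × {v : InfinitePlace F // v.IsReal}) → ℝ))
    (k : UnitaryGroup.arch F E c N J) (a : 𝓢(D, ℂ)) :
    carrierConjEquiv S (archWeilSectionS E c N hc wOf hw hover t₀ ht0 hTd hJ hcδ hδ k).1.2 a =
      ((((schwartzTransport S).trans
          (schwartzTransport (reindexCLE (placeSplitEquiv (signSplit (signVec wOf t₀ δ σ)) σ)))).trans
          (schwartzTransport (reindexCLE (Equiv.sumCongr (unitJunctionIdx (PosIdx (signVec wOf t₀ δ σ)) (NegIdx (signVec wOf t₀ δ σ))).symm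
            (Equiv.refl (Fin N × {v : {v : InfinitePlace F // v.IsReal} // v ≠ σ})))))).trans
          (schwartzTransport (reindexCLE (Equiv.sumCongr
            (dpIdxCongr (PosIdx (signVec wOf t₀ δ σ)) (NegIdx (signVec wOf t₀ δ σ)) Unit Empty P' Q' Unit Empty eP eQ (Equiv.refl Unit)
              (Equiv.refl Empty)).symm
            (Equiv.refl (Fin N × {v : {v : InfinitePlace F // v.IsReal} // v ≠ σ})))))).symm
        (archSectionRepJ E c N hc wOf hw t₀ ht0 hcδ hδ σ hover hTd hJ eP eQ k
          (((((schwartzTransport S).trans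
            (schwartzTransport (reindexCLE (placeSplitEquiv (signSplit (signVec wOf t₀ δ σ)) σ)))).trans
            (schwartzTransport (reindexCLE (Equiv.sumCongr (unitJunctionIdx (PosIdx (signVec wOf t₀ δ σ)) (NegIdx (signVec wOf t₀ δ σ))).symm
              (Equiv.refl (Fin N × {v : {v : InfinitePlace F // v.IsReal} // v ≠ σ})))))).trans
            (schwartzTransport (reindexCLE (Equiv.sumCongr
              (dpIdxCongr (PosIdx (signVec wOf t₀ δ σ)) (NegIdx (signVec wOf t₀ δ σ)) Unit Empty P' Q' Unit Empty eP eQ (Equiv.refl Unit)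
                (Equiv.refl Empty)).symm
              (Equiv.refl (Fin N × {v : {v : InfinitePlace F // v.IsReal} // v ≠ σ})))))) a)) := by
  simp only [archSectionRepJ, repTransport_apply, MonoidHom.comp_apply, MpS.toEnd_apply, carrierConjEquiv_apply,
    ContinuousLinearEquiv.trans_apply, ContinuousLinearEquiv.symm_trans_apply, ContinuousLinearEquiv.symm_apply_apply]
end Frame

/-! ## §2 The doubled CM frame: one continuous linear functional on `𝓢(ℝ^{J_σ})` reads every translate along `placeSecJ σ` -/
section Doubled
variable (L : Type) [Field L] [NumberField L] [IsCMField L]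

variable {N M n : ℕ} (e : Fin N × Fin M ≃ Fin n)
  (dV : Fin N → L) (hdV : ∀ i, IsCMField.complexConj L (dV i) = dV i) (hdV0 : ∀ i, dV i ≠ 0)
  (dW : Fin M → L) (hdW : ∀ i, IsCMField.complexConj L (dW i) = dW i) (hdW0 : ∀ i, dW i ≠ 0)
  (σ : {v : InfinitePlace (Fp L) // v.IsReal})
  {P' Q' : Type} [Fintype P'] [DecidableEq P'] [Fintype Q'] [DecidableEq Q']
  (eP : PosIdx (signVec (cmPlaceOver L)
      (fun k => Sum.elim (cmGramEntry L e dV hdV dW hdW) (-cmGramEntry L e dV hdV dW hdW) ((LocalSplitting.e₂ n).symm k)) (imagUnit L) σ) ≃ P')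
  (eQ : NegIdx (signVec (cmPlaceOver L)
      (fun k => Sum.elim (cmGramEntry L e dV hdV dW hdW) (-cmGramEntry L e dV hdV dW hdW) ((LocalSplitting.e₂ n).symm k)) (imagUnit L) σ) ≃ Q')

-- the doubled metaplectic carrier `Mp(𝕎^𝔻)ᶜᵒⁿᵗ` and the CM sign frame elaborate slowly (cf. ★ `K2LiuSwSectionArchOrbitSmooth`: 2 000 000 heartbeats)
set_option maxHeartbeats 2000000

include hdV0 hdW0 in
/-- **`u ↦ η_t(placeSecJ σ u)` is continuous** (★ `continuous_coe_archDetZPow` — `etaD t` IS a `det`-power character — along ★ `continuous_placeSecJ`).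
[cite: Paul1998, §1.2 (1.2.2) p. 389] -/
theorem continuous_coe_etaD_placeSecJ (t : InfinitePlace L → ℤ) :
    Continuous fun u : Ginf P' Q' Unit Empty =>
      ((etaD L e dV hdV dW hdW t
        (placeSecJ L (IsCMField.complexConj L) (n + n) (IsCMField.complexConj_ne_one L) (cmPlaceOver L) (cmPlaceOver_smul L) _
          (gramD_gram_realDiagonal_entry_ne_zero L e dV hdV dW hdW hdV0 hdW0) (complexConj_imagUnit L) (imagUnit_ne_zero L) σ
          (cmPlaceOver_comap L) (gramD_eq_diagonal_cm L e dV hdV dW hdW) (J := hermD L e dV hdV dW hdW) rfl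
          (complexConj_smul_infinitePlace L) eP eQ u) : ℂˣ) : ℂ) :=
  (continuous_coe_archDetZPow (Fp L) L (IsCMField.complexConj L) (n + n) (hermD L e dV hdV dW hdW) (IsCMField.complexConj_ne_one L)
      (cmPlaceOver L) (cmPlaceOver_smul L) fun v => (t (cmPlaceOver L v).1 + 1) / 2).comp
    (continuous_placeSecJ L (IsCMField.complexConj L) (n + n) (IsCMField.complexConj_ne_one L) (cmPlaceOver L) (cmPlaceOver_smul L) _
      (gramD_gram_realDiagonal_entry_ne_zero L e dV hdV dW hdW hdV0 hdW0) (complexConj_imagUnit L) (imagUnit_ne_zero L) σ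
      (cmPlaceOver_comap L) (gramD_eq_diagonal_cm L e dV hdV dW hdW) rfl (complexConj_smul_infinitePlace L) eP eQ)

/-- **ONE CONTINUOUS LINEAR FUNCTIONAL ON `𝓢(ℝ^{J_σ})` READS EVERY TRANSLATE ALONG `placeSecJ σ`.**  For `sD`, `χ`, `t`, `h`, `f` as in ★
`exists_clm_swSection_tmul_mul_archToAdelic` there is a continuous linear functional `ℓ′` on the junction-frame Schwartz space `𝓢(ℝ^{DPIdx P′ Q′ 1 ∅ ⊕ (Fin N × {v ≠ σ})})`
with `swSection sD (a ⊗ f) (h · placeSecJ σ u) = η_t(placeSecJ σ u) · ℓ′ (archSectionRepJ σ (placeSecJ σ u) (𝒥 a))` for EVERY `u ∈ U(P′,Q′) × U(1,0)` and every `a ∈ 𝓢(X_∞)`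
(`ℓ′ = ℓ ∘ 𝒥⁻¹`, §1). [cite: Weil1964, Chap. I n° 11–12, Chap. III n° 39 p. 189] [cite: GelbartRogawski1991, §3.1 Prop. 3.1.1 p. 455] [cite: KudlaRallis1994, §1] -/
theorem exists_clm_swSection_tmul_mul_archEmb_placeSecJ {χ : HeckeCharacter L} (hχu : χ.IsUnitary) (hχs : IsSplittingChar L 1 χ)
    {sD : HA L e dV hdV dW hdW →* MpD L e dV hdV dW hdW} (hsD : IsDoubledWeilRep L e dV hdV hdV0 dW hdW hdW0 χ sD)
    {t : InfinitePlace L → ℤ} (ht : χ.HasUnitaryArchType t 0) (hodd : ∀ w, Odd (t w)) (h : HA L e dV hdV dW hdW)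
    (f : FinSB (Fp L) (Fin (n + n))) :
    ∃ ℓ' : 𝓢(((DPIdx P' Q' Unit Empty ⊕ (Fin (n + n) × {v : {v : InfinitePlace (Fp L) // v.IsReal} // v ≠ σ})) → ℝ), ℂ) →L[ℂ] ℂ,
      ∀ (u : Ginf P' Q' Unit Empty) (a : 𝓢((Fin (n + n) → mixedSpace (Fp L)), ℂ)),
        swSection L e dV hdV hdV0 dW hdW hdW0 sD (piSchwartzBruhatEquiv (Fp L) (Fin (n + n)) (a ⊗ₜ f))
            (h * K2LiuArchOneParameterOrbitDefs.archEmb (Fp L) L (IsCMField.complexConj L) (n + n) (hermD L e dV hdV dW hdW)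
              (placeSecJ L (IsCMField.complexConj L) (n + n) (IsCMField.complexConj_ne_one L) (cmPlaceOver L) (cmPlaceOver_smul L) _
                (gramD_gram_realDiagonal_entry_ne_zero L e dV hdV dW hdW hdV0 hdW0) (complexConj_imagUnit L) (imagUnit_ne_zero L) σ
                (cmPlaceOver_comap L) (gramD_eq_diagonal_cm L e dV hdV dW hdW) (J := hermD L e dV hdV dW hdW) rfl
                (complexConj_smul_infinitePlace L) eP eQ u)) =
          (((etaD L e dV hdV dW hdW t
              (placeSecJ L (IsCMField.complexConj L) (n + n) (IsCMField.complexConj_ne_one L) (cmPlaceOver L) (cmPlaceOver_smul L) _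
                (gramD_gram_realDiagonal_entry_ne_zero L e dV hdV dW hdW hdV0 hdW0) (complexConj_imagUnit L) (imagUnit_ne_zero L) σ
                (cmPlaceOver_comap L) (gramD_eq_diagonal_cm L e dV hdV dW hdW) (J := hermD L e dV hdV dW hdW) rfl
                (complexConj_smul_infinitePlace L) eP eQ u) : ℂˣ) : ℂ)) *
            ℓ' (archSectionRepJ L (IsCMField.complexConj L) (n + n) (IsCMField.complexConj_ne_one L) (cmPlaceOver L) (cmPlaceOver_smul L) _
                (gramD_gram_realDiagonal_entry_ne_zero L e dV hdV dW hdW hdV0 hdW0) (complexConj_imagUnit L) (imagUnit_ne_zero L) σ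
                (cmPlaceOver_comap L) (gramD_eq_diagonal_cm L e dV hdV dW hdW) (J := hermD L e dV hdV dW hdW) rfl eP eQ
              (placeSecJ L (IsCMField.complexConj L) (n + n) (IsCMField.complexConj_ne_one L) (cmPlaceOver L) (cmPlaceOver_smul L) _
                (gramD_gram_realDiagonal_entry_ne_zero L e dV hdV dW hdW hdV0 hdW0) (complexConj_imagUnit L) (imagUnit_ne_zero L) σ
                (cmPlaceOver_comap L) (gramD_eq_diagonal_cm L e dV hdV dW hdW) (J := hermD L e dV hdV dW hdW) rfl
                (complexConj_smul_infinitePlace L) eP eQ u)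
              (((((schwartzTransport
                  (scaledFrame (Fp L) (Fin (n + n))
                    (placeScale (n + n) fun v => sqrtAbs (signVec (cmPlaceOver L)
                      (fun k => Sum.elim (cmGramEntry L e dV hdV dW hdW) (-cmGramEntry L e dV hdV dW hdW) ((LocalSplitting.e₂ n).symm k))
                      (imagUnit L) v))
                    (placeScale_ne_zero (n + n) (sqrtAbs_signVec_ne_zero (IsCMField.complexConj_ne_one L) (cmPlaceOver_smul L)
                      (complexConj_imagUnit L) (imagUnit_ne_zero L) (gramD_gram_realDiagonal_entry_ne_zero L e dV hdV dW hdW hdV0 hdW0))))).trans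
                (schwartzTransport (reindexCLE (placeSplitEquiv (signSplit (signVec (cmPlaceOver L)
                  (fun k => Sum.elim (cmGramEntry L e dV hdV dW hdW) (-cmGramEntry L e dV hdV dW hdW) ((LocalSplitting.e₂ n).symm k))
                  (imagUnit L) σ)) σ)))).trans
                (schwartzTransport (reindexCLE (Equiv.sumCongr
                  (unitJunctionIdx
                    (PosIdx (signVec (cmPlaceOver L)
                      (fun k => Sum.elim (cmGramEntry L e dV hdV dW hdW) (-cmGramEntry L e dV hdV dW hdW) ((LocalSplitting.e₂ n).symm k))
                      (imagUnit L) σ))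
                    (NegIdx (signVec (cmPlaceOver L)
                      (fun k => Sum.elim (cmGramEntry L e dV hdV dW hdW) (-cmGramEntry L e dV hdV dW hdW) ((LocalSplitting.e₂ n).symm k))
                      (imagUnit L) σ))).symm
                  (Equiv.refl (Fin (n + n) × {v : {v : InfinitePlace (Fp L) // v.IsReal} // v ≠ σ})))))).trans
                (schwartzTransport (reindexCLE (Equiv.sumCongr
                  (dpIdxCongr
                    (PosIdx (signVec (cmPlaceOver L)
                      (fun k => Sum.elim (cmGramEntry L e dV hdV dW hdW) (-cmGramEntry L e dV hdV dW hdW) ((LocalSplitting.e₂ n).symm k))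
                      (imagUnit L) σ))
                    (NegIdx (signVec (cmPlaceOver L)
                      (fun k => Sum.elim (cmGramEntry L e dV hdV dW hdW) (-cmGramEntry L e dV hdV dW hdW) ((LocalSplitting.e₂ n).symm k))
                      (imagUnit L) σ))
                    Unit Empty P' Q' Unit Empty eP eQ (Equiv.refl Unit) (Equiv.refl Empty)).symm
                  (Equiv.refl (Fin (n + n) × {v : {v : InfinitePlace (Fp L) // v.IsReal} // v ≠ σ})))))) a)) := by
  obtain ⟨ℓ, hℓ⟩ := exists_clm_swSection_tmul_mul_archToAdelic L e dV hdV hdV0 dW hdW hdW0 hχu hχs hsD ht hodd h f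
  refine ⟨ℓ.comp (( ((((schwartzTransport
                  (scaledFrame (Fp L) (Fin (n + n))
                    (placeScale (n + n) fun v => sqrtAbs (signVec (cmPlaceOver L)
                      (fun k => Sum.elim (cmGramEntry L e dV hdV dW hdW) (-cmGramEntry L e dV hdV dW hdW) ((LocalSplitting.e₂ n).symm k))
                      (imagUnit L) v))
                    (placeScale_ne_zero (n + n) (sqrtAbs_signVec_ne_zero (IsCMField.complexConj_ne_one L) (cmPlaceOver_smul L)
                      (complexConj_imagUnit L) (imagUnit_ne_zero L) (gramD_gram_realDiagonal_entry_ne_zero L e dV hdV dW hdW hdV0 hdW0))))).trans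
                (schwartzTransport (reindexCLE (placeSplitEquiv (signSplit (signVec (cmPlaceOver L)
                  (fun k => Sum.elim (cmGramEntry L e dV hdV dW hdW) (-cmGramEntry L e dV hdV dW hdW) ((LocalSplitting.e₂ n).symm k))
                  (imagUnit L) σ)) σ)))).trans
                (schwartzTransport (reindexCLE (Equiv.sumCongr
                  (unitJunctionIdx
                    (PosIdx (signVec (cmPlaceOver L)
                      (fun k => Sum.elim (cmGramEntry L e dV hdV dW hdW) (-cmGramEntry L e dV hdV dW hdW) ((LocalSplitting.e₂ n).symm k))
                      (imagUnit L) σ))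
                    (NegIdx (signVec (cmPlaceOver L)
                      (fun k => Sum.elim (cmGramEntry L e dV hdV dW hdW) (-cmGramEntry L e dV hdV dW hdW) ((LocalSplitting.e₂ n).symm k))
                      (imagUnit L) σ))).symm
                  (Equiv.refl (Fin (n + n) × {v : {v : InfinitePlace (Fp L) // v.IsReal} // v ≠ σ})))))).trans
                (schwartzTransport (reindexCLE (Equiv.sumCongr
                  (dpIdxCongr
                    (PosIdx (signVec (cmPlaceOver L)
                      (fun k => Sum.elim (cmGramEntry L e dV hdV dW hdW) (-cmGramEntry L e dV hdV dW hdW) ((LocalSplitting.e₂ n).symm k))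
                      (imagUnit L) σ))
                    (NegIdx (signVec (cmPlaceOver L)
                      (fun k => Sum.elim (cmGramEntry L e dV hdV dW hdW) (-cmGramEntry L e dV hdV dW hdW) ((LocalSplitting.e₂ n).symm k))
                      (imagUnit L) σ))
                    Unit Empty P' Q' Unit Empty eP eQ (Equiv.refl Unit) (Equiv.refl Empty)).symm
                  (Equiv.refl (Fin (n + n) × {v : {v : InfinitePlace (Fp L) // v.IsReal} // v ≠ σ})))))).symm :
      𝓢(((DPIdx P' Q' Unit Empty ⊕ (Fin (n + n) × {v : {v : InfinitePlace (Fp L) // v.IsReal} // v ≠ σ})) → ℝ), ℂ) →L[ℂ]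
        𝓢((Fin (n + n) → mixedSpace (Fp L)), ℂ))), fun u a => ?_⟩
  rw [hℓ]
  -- `ℓ (C_k a) = (ℓ ∘ 𝒥⁻¹) (archSectionRepJ k (𝒥 a))` by the frame identity of §1 (`ContinuousLinearMap.comp_apply` is definitional)
  congr 1
  exact congrArg ℓ (carrierConjEquiv_eq_symm_archSectionRepJ L (IsCMField.complexConj L) (n + n) (IsCMField.complexConj_ne_one L) (cmPlaceOver L)
    (cmPlaceOver_smul L) _ (gramD_gram_realDiagonal_entry_ne_zero L e dV hdV dW hdW hdV0 hdW0) (complexConj_imagUnit L) (imagUnit_ne_zero L) σ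
    (cmPlaceOver_comap L) (gramD_eq_diagonal_cm L e dV hdV dW hdW) rfl eP eQ _ _ a)
end Doubled

/-! ## §3 Smoothness along `U(2,2)` at `σ` on product vectors -/
section Smooth
variable (L : Type) [Field L] [NumberField L] [IsCMField L]

variable {N M n : ℕ} (e : Fin N × Fin M ≃ Fin n)
  (dV : Fin N → L) (hdV : ∀ i, IsCMField.complexConj L (dV i) = dV i) (hdV0 : ∀ i, dV i ≠ 0)
  (dW : Fin M → L) (hdW : ∀ i, IsCMField.complexConj L (dW i) = dW i) (hdW0 : ∀ i, dW i ≠ 0)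
  (σ : {v : InfinitePlace (Fp L) // v.IsReal})
  (e₂P : PosIdx (signVec (cmPlaceOver L)
      (fun k => Sum.elim (cmGramEntry L e dV hdV dW hdW) (-cmGramEntry L e dV hdV dW hdW) ((LocalSplitting.e₂ n).symm k)) (imagUnit L) σ) ≃ Fin 2)
  (e₂Q : NegIdx (signVec (cmPlaceOver L)
      (fun k => Sum.elim (cmGramEntry L e dV hdV dW hdW) (-cmGramEntry L e dV hdV dW hdW) ((LocalSplitting.e₂ n).symm k)) (imagUnit L) σ) ≃ Fin 2)

/-- **THE SIEGEL–WEIL SECTION IS `C^∞` ALONG `U(2,2)` AT A REAL PLACE ON PRODUCT VECTORS.**  Let `sD` be ANY `χ`-normalised doubled Weil representation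
(`χ` unitary, `χ|_{𝕀_{L⁺}} = ε`, odd unitary archimedean type `(t, 0)`), `h ∈ H(𝔸)`, `f ∈ 𝒮(X_f)`, `σ` a real place whose sign types are `P_σ ≃ Fin 2`, `Q_σ ≃ Fin 2`,
`c : B → U(2,2)` a map `C^∞` at `x₀` as a matrix-valued map, and `a ∈ 𝓢(X_∞)` an archimedean vector whose reading in the junction frame at `σ` is a PRODUCT VECTOR
`𝒥 a = Φ₁ ⊠ Φ₂` (`Φ₁` in the four `σ`-variables, `Φ₂` in the others).  Then `x ↦ swSection sD (a ⊗ f) (h · placeSecJ σ (c x, 1))` is `C^∞` at `x₀`: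
by §2 it is the product of the continuous character `x ↦ η_t(placeSecJ σ (c x, 1))` (smooth: ★ `contDiffAt_character_inl`) and of
`x ↦ ℓ′ (archSectionRepJ σ (placeSecJ σ (c x, 1)) (Φ₁ ⊠ Φ₂))` (smooth: ★ `contDiffAt_archSectionRepJ_placeSecJ`, `T′ = ℓ′` read over `ℝ`).
[cite: Varadarajan1984, Thm. 2.10.1, Thm. 2.11.2] [cite: Folland1989, Prop. (1.43), §4.2 (4.23)–(4.24), Prop. (4.39)] [cite: Weil1964, Chap. III n° 39 p. 189]
[cite: KudlaRallis1994, §1] -/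
theorem contDiffAt_swSection_tmul_placeSecJ {χ : HeckeCharacter L} (hχu : χ.IsUnitary) (hχs : IsSplittingChar L 1 χ)
    {sD : HA L e dV hdV dW hdW →* MpD L e dV hdV dW hdW} (hsD : IsDoubledWeilRep L e dV hdV hdV0 dW hdW hdW0 χ sD)
    {t : InfinitePlace L → ℤ} (ht : χ.HasUnitaryArchType t 0) (hodd : ∀ w, Odd (t w)) (h : HA L e dV hdV dW hdW)
    (f : FinSB (Fp L) (Fin (n + n)))
    {B : Type*} [NormedAddCommGroup B] [NormedSpace ℝ B] {c' : B → UForm (Fin 2) (Fin 2)} {x₀ : B}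
    (hc' : ContDiffAt ℝ ((⊤ : ℕ∞) : WithTop ℕ∞) (fun x => ((c' x : GL (Fin 2 ⊕ Fin 2) ℂ) : Matrix (Fin 2 ⊕ Fin 2) (Fin 2 ⊕ Fin 2) ℂ)) x₀)
    (Φ₁ : 𝓢((DPIdx (Fin 2) (Fin 2) Unit Empty → ℝ), ℂ))
    (Φ₂ : 𝓢(((Fin (n + n) × {v : {v : InfinitePlace (Fp L) // v.IsReal} // v ≠ σ}) → ℝ), ℂ))
    {a : 𝓢((Fin (n + n) → mixedSpace (Fp L)), ℂ)}
    (ha : ((((schwartzTransport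
                  (scaledFrame (Fp L) (Fin (n + n))
                    (placeScale (n + n) fun v => sqrtAbs (signVec (cmPlaceOver L)
                      (fun k => Sum.elim (cmGramEntry L e dV hdV dW hdW) (-cmGramEntry L e dV hdV dW hdW) ((LocalSplitting.e₂ n).symm k))
                      (imagUnit L) v))
                    (placeScale_ne_zero (n + n) (sqrtAbs_signVec_ne_zero (IsCMField.complexConj_ne_one L) (cmPlaceOver_smul L)
                      (complexConj_imagUnit L) (imagUnit_ne_zero L) (gramD_gram_realDiagonal_entry_ne_zero L e dV hdV dW hdW hdV0 hdW0))))).trans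
                (schwartzTransport (reindexCLE (placeSplitEquiv (signSplit (signVec (cmPlaceOver L)
                  (fun k => Sum.elim (cmGramEntry L e dV hdV dW hdW) (-cmGramEntry L e dV hdV dW hdW) ((LocalSplitting.e₂ n).symm k))
                  (imagUnit L) σ)) σ)))).trans
                (schwartzTransport (reindexCLE (Equiv.sumCongr
                  (unitJunctionIdx
                    (PosIdx (signVec (cmPlaceOver L)
                      (fun k => Sum.elim (cmGramEntry L e dV hdV dW hdW) (-cmGramEntry L e dV hdV dW hdW) ((LocalSplitting.e₂ n).symm k))
                      (imagUnit L) σ))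
                    (NegIdx (signVec (cmPlaceOver L)
                      (fun k => Sum.elim (cmGramEntry L e dV hdV dW hdW) (-cmGramEntry L e dV hdV dW hdW) ((LocalSplitting.e₂ n).symm k))
                      (imagUnit L) σ))).symm
                  (Equiv.refl (Fin (n + n) × {v : {v : InfinitePlace (Fp L) // v.IsReal} // v ≠ σ})))))).trans
                (schwartzTransport (reindexCLE (Equiv.sumCongr
                  (dpIdxCongr
                    (PosIdx (signVec (cmPlaceOver L)
                      (fun k => Sum.elim (cmGramEntry L e dV hdV dW hdW) (-cmGramEntry L e dV hdV dW hdW) ((LocalSplitting.e₂ n).symm k))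
                      (imagUnit L) σ))
                    (NegIdx (signVec (cmPlaceOver L)
                      (fun k => Sum.elim (cmGramEntry L e dV hdV dW hdW) (-cmGramEntry L e dV hdV dW hdW) ((LocalSplitting.e₂ n).symm k))
                      (imagUnit L) σ))
                    Unit Empty (Fin 2) (Fin 2) Unit Empty e₂P e₂Q (Equiv.refl Unit) (Equiv.refl Empty)).symm
                  (Equiv.refl (Fin (n + n) × {v : {v : InfinitePlace (Fp L) // v.IsReal} // v ≠ σ})))))) a =
          tensorPi Φ₁ Φ₂) :
    ContDiffAt ℝ ((⊤ : ℕ∞) : WithTop ℕ∞)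
      (fun x => swSection L e dV hdV hdV0 dW hdW hdW0 sD (piSchwartzBruhatEquiv (Fp L) (Fin (n + n)) (a ⊗ₜ f))
        (h * K2LiuArchOneParameterOrbitDefs.archEmb (Fp L) L (IsCMField.complexConj L) (n + n) (hermD L e dV hdV dW hdW)
          (placeSecJ L (IsCMField.complexConj L) (n + n) (IsCMField.complexConj_ne_one L) (cmPlaceOver L) (cmPlaceOver_smul L) _
            (gramD_gram_realDiagonal_entry_ne_zero L e dV hdV dW hdW hdV0 hdW0) (complexConj_imagUnit L) (imagUnit_ne_zero L) σ
            (cmPlaceOver_comap L) (gramD_eq_diagonal_cm L e dV hdV dW hdW) (J := hermD L e dV hdV dW hdW) rfl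
            (complexConj_smul_infinitePlace L) e₂P e₂Q ((c' x, (1 : UForm Unit Empty)) : Ginf (Fin 2) (Fin 2) Unit Empty)))) x₀ := by
  obtain ⟨ℓ', hℓ'⟩ := exists_clm_swSection_tmul_mul_archEmb_placeSecJ L e dV hdV hdV0 dW hdW hdW0 σ e₂P e₂Q hχu hχs hsD ht hodd h f
  simp only [hℓ', ha]
  -- the character leg `x ↦ η_t(placeSecJ σ (c x, 1))`
  have hη : ContDiffAt ℝ ((⊤ : ℕ∞) : WithTop ℕ∞)
      (fun x => ((etaD L e dV hdV dW hdW t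
        (placeSecJ L (IsCMField.complexConj L) (n + n) (IsCMField.complexConj_ne_one L) (cmPlaceOver L) (cmPlaceOver_smul L) _
          (gramD_gram_realDiagonal_entry_ne_zero L e dV hdV dW hdW hdV0 hdW0) (complexConj_imagUnit L) (imagUnit_ne_zero L) σ
          (cmPlaceOver_comap L) (gramD_eq_diagonal_cm L e dV hdV dW hdW) (J := hermD L e dV hdV dW hdW) rfl
          (complexConj_smul_infinitePlace L) e₂P e₂Q ((c' x, (1 : UForm Unit Empty)) : Ginf (Fin 2) (Fin 2) Unit Empty)) : ℂˣ) : ℂ)) x₀ :=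
    K2LiuWeilDatumSmoothU22.contDiffAt_character_inl
      (χ := (Units.coeHom ℂ).comp ((etaD L e dV hdV dW hdW t).comp
        (placeSecJ L (IsCMField.complexConj L) (n + n) (IsCMField.complexConj_ne_one L) (cmPlaceOver L) (cmPlaceOver_smul L) _
          (gramD_gram_realDiagonal_entry_ne_zero L e dV hdV dW hdW hdV0 hdW0) (complexConj_imagUnit L) (imagUnit_ne_zero L) σ
          (cmPlaceOver_comap L) (gramD_eq_diagonal_cm L e dV hdV dW hdW) (J := hermD L e dV hdV dW hdW) rfl
          (complexConj_smul_infinitePlace L) e₂P e₂Q)))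
      (continuous_coe_etaD_placeSecJ L e dV hdV hdV0 dW hdW hdW0 σ e₂P e₂Q t) hc'
  -- the Folland leg `x ↦ ℓ′ (archSectionRepJ σ (placeSecJ σ (c x, 1)) (Φ₁ ⊠ Φ₂))`
  have hF := contDiffAt_archSectionRepJ_placeSecJ L (IsCMField.complexConj L) (n + n) (IsCMField.complexConj_ne_one L) (cmPlaceOver L)
    (cmPlaceOver_smul L) _ (gramD_gram_realDiagonal_entry_ne_zero L e dV hdV dW hdW hdV0 hdW0) (complexConj_imagUnit L) (imagUnit_ne_zero L) σ
    (cmPlaceOver_comap L) (gramD_eq_diagonal_cm L e dV hdV dW hdW) (J := hermD L e dV hdV dW hdW) rfl (complexConj_smul_infinitePlace L)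
    e₂P e₂Q hc' ((ℓ' : _ →L[ℂ] ℂ).restrictScalars ℝ) Φ₁ Φ₂
  exact hη.mul hF

end Smooth

end Summit.HodgeConjecture.HodgeConjecture.Cruxes.HLiu418.K2LiuSwSectionArchOrbit

end
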